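/- WIDTH SEAT `ym-line-cbag-p1-w3` (prover-ym-line-cbag-p1-w3-g12-0), route `EguchiKawaiDirectionLadder` (ideator ym-idea-2, LINE 8),
crux `TripleSmallBallMargin` (stmt-QuantumFields-27724), LEAD g24's v7 architecture, stubs S7/S8: the PAIR (two-link, `ekHaar 2 N`) form
of the rank-robust reduction `RankRobust.haar_rankRobust_le` — Fubini over the first link, which plays the role of the fixed unitary
`D` (no diagonalisation, no Weyl formula) — and the identification of the single-commutator robust pair event with w4's
`robustCommEvent` shape (measurability).  ROUTE-INDEPENDENT (no Theses import).  Nothing here bears on the Yang–Mills mass gap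
(barrier-ledger line onto `EguchiKawaiBreakdown`). -/
import Summits.QuantumFields.YangMills.Theorems.EguchiKawaiDirectionLadderRankRobustReduction
import Summits.QuantumFields.YangMills.Theorems.EguchiKawaiDirectionLadderFirstLinkFibre
import Summits.QuantumFields.YangMills.Theorems.EguchiKawaiDirectionLadderSingleLinkReductionCore

/-!
# Route `EguchiKawaiDirectionLadder`, stubs S7/S8: the rank-robust PAIR small-ball event reduces to the plain one

* `robustPairEvent_eq` — `{U ∈ U(N)² | ∃ R, rank R ≤ s, ‖[U₀,U₁] − R‖_F² ≤ a}` equals w4's event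
  `{U | ∃ R_{μν}, rank R_{μν} ≤ s, Σ_{μν} ‖[U_μ,U_ν] − R_{μν}‖_F² ≤ 2a}` (`[U₁,U₀] = −[U₀,U₁]`, the diagonal commutators vanish; conversely
  the smaller of the two off-diagonal terms is `≤ a`), hence is measurable (`isClosed_robustCommEvent`);
* `ekHaar_one_setOf_apply_zero` — `ekHaar 1 N {W | W 0 ∈ S} = Haar(S)`;
* `ekHaar_two_rankRobust_le` — for `s ≤ N`, `0 < t ≤ 1`:
  `ekHaar 2 N {∃ R, rank R ≤ s, ‖[U₀,U₁] − R‖_F² ≤ N t} ≤ 33^{N²}(100/t²)^{sN} · ekHaar 2 N {‖[U₀,U₁]‖_F² ≤ 36 N t}`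
  (Fubini over `U₀` = w4's `ekHaar_succ_eq_lintegral_firstFibre`, then `haar_rankRobust_le` with `D := U₀` in each fibre);
* `ekHaar_two_rankRobust_le_ekAction` — the same with the plain event written `{S_R ≤ 18 t}` (`S_R = ‖[U₀,U₁]‖_F²/(2N)` for `d = 2`,
  `N ≥ 1`), the form consumed by the pair small-ball bound (S4, `PairSmallBall`).

This is (Ψ_rob) ⇐ (Ψ) of the architecture note ARCH-27724-lead-g24 §3 with loss `t^{−2sN} e^{O(N²)}`.  All [folklore].
-/

set_option autoImplicit false

noncomputable section

open MeasureTheory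
open scoped Matrix ENNReal
open Literature.Barriers.QuantumFields
open Literature.MathematicalPhysics.QuantumFieldTheory (haarProbability)

namespace Summit.QuantumFields.YangMills.Theorems.EguchiKawaiDirectionLadder

namespace RankRobust

variable {N : ℕ}

/-! ### The robust pair event in w4's shape; measurability -/

/-- `[U₁, U₀] = −[U₀, U₁]`. -/
theorem ekComm_one_zero (U : EKConfig 2 N) : ekComm U 1 0 = -ekComm U 0 1 := by
  unfold ekComm; rw [neg_sub]

/-- **The single-commutator robust pair event is w4's `robustCommEvent` for `d = 2`** (rank bound `s` on every `(μ,ν)`,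
threshold doubled). -/
theorem robustPairEvent_eq (N s : ℕ) (a : ℝ) :
    {U : EKConfig 2 N | ∃ R : Matrix (Fin N) (Fin N) ℂ, R.rank ≤ s ∧ frobSq (ekComm U 0 1 - R) ≤ a} =
    {U : EKConfig 2 N | ∃ R : Fin 2 → Fin 2 → Matrix (Fin N) (Fin N) ℂ,
      (∀ μ ν, ((R μ ν).rank : ℝ) ≤ (s : ℝ)) ∧ ∑ μ, ∑ ν, frobSq (ekComm U μ ν - R μ ν) ≤ 2 * a} := by
  ext U
  simp only [Set.mem_setOf_eq]
  have hanti := ekComm_one_zero U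
  constructor
  · rintro ⟨R, hR, hRa⟩
    refine ⟨fun μ ν => if μ = 0 then (if ν = 1 then R else 0) else (if ν = 0 then -R else 0), ?_, ?_⟩
    · intro μ ν
      by_cases hμ : μ = 0
      · by_cases hν : ν = 1
        · simp only [hμ, hν, if_true]; exact_mod_cast hR
        · simp [hμ, hν]
      · by_cases hν : ν = 0
        · simp only [hμ, hν, if_true, if_false]; rw [rank_neg]; exact_mod_cast hR
        · simp [hμ, hν]
    · rw [Fin.sum_univ_two, Fin.sum_univ_two, Fin.sum_univ_two]
      simp only [if_true, if_false, one_ne_zero, zero_ne_one, ekComm_self, hanti, sub_self]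
      have h0 : frobSq (0 : Matrix (Fin N) (Fin N) ℂ) = 0 := by simp [frobSq]
      have hneg : frobSq (-ekComm U 0 1 - -R) = frobSq (ekComm U 0 1 - R) := by
        rw [show -ekComm U 0 1 - -R = -(ekComm U 0 1 - R) by abel, frobSq_neg]
      rw [hneg, h0]
      linarith
  · rintro ⟨R', hR', hsum⟩
    have h01 : frobSq (ekComm U 0 1 - R' 0 1) + frobSq (ekComm U 1 0 - R' 1 0) ≤ 2 * a := by
      rw [Fin.sum_univ_two, Fin.sum_univ_two, Fin.sum_univ_two] at hsum
      have h1 := frobSq_nonneg (ekComm U 0 0 - R' 0 0)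
      have h2 := frobSq_nonneg (ekComm U 1 1 - R' 1 1)
      linarith
    have h10 : frobSq (ekComm U 1 0 - R' 1 0) = frobSq (ekComm U 0 1 - (-R' 1 0)) := by
      rw [hanti, ← frobSq_neg (ekComm U 0 1 - (-R' 1 0))]
      congr 1; abel
    by_cases hle : frobSq (ekComm U 0 1 - R' 0 1) ≤ a
    · exact ⟨R' 0 1, by exact_mod_cast hR' 0 1, hle⟩
    · refine ⟨-R' 1 0, ?_, ?_⟩
      · rw [rank_neg]; exact_mod_cast hR' 1 0
      · rw [← h10]
        push Not at hle
        linarith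

/-- The single-commutator robust pair event is measurable. -/
theorem measurableSet_robustPairEvent (N s : ℕ) (a : ℝ) :
    MeasurableSet {U : EKConfig 2 N | ∃ R : Matrix (Fin N) (Fin N) ℂ, R.rank ≤ s ∧ frobSq (ekComm U 0 1 - R) ≤ a} := by
  rw [robustPairEvent_eq]
  exact measurableSet_robustCommEvent (fun _ _ => (s : ℝ)) (2 * a)

/-- `U ↦ ‖[U₀,U₁]‖_F²` is continuous. -/
theorem continuous_frobSq_ekComm (μ ν : Fin 2) : Continuous fun U : EKConfig 2 N => frobSq (ekComm U μ ν) := by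
  have hcomm : Continuous fun U : EKConfig 2 N => ekComm U μ ν := by
    unfold ekComm
    exact ((continuous_coeLink μ).mul (continuous_coeLink ν)).sub ((continuous_coeLink ν).mul (continuous_coeLink μ))
  have hentry : ∀ i j : Fin N, Continuous fun M : Matrix (Fin N) (Fin N) ℂ => M i j := fun i j =>
    (continuous_apply j).comp (continuous_apply i)
  have hfrob : Continuous fun M : Matrix (Fin N) (Fin N) ℂ => frobSq M := by
    unfold frobSq
    exact continuous_finsetSum _ fun i _ => continuous_finsetSum _ fun j _ => ((hentry i j).norm.pow 2)
  exact hfrob.comp hcomm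

/-- The plain pair event `{‖[U₀,U₁]‖_F² ≤ c}` is measurable. -/
theorem measurableSet_plainPairEvent (N : ℕ) (c : ℝ) :
    MeasurableSet {U : EKConfig 2 N | frobSq (ekComm U 0 1) ≤ c} :=
  (isClosed_le (continuous_frobSq_ekComm 0 1) continuous_const).measurableSet

/-! ### One-link configurations and the first-link fibres -/

/-- `ekHaar 1 N {W | W 0 ∈ S} = Haar(S)` (the one-link configuration space is `U(N)`). -/
theorem ekHaar_one_setOf_apply_zero (S : Set (UN N)) :
    ekHaar 1 N {W : EKConfig 1 N | W 0 ∈ S} = haarProbability (UN N) S := by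
  have hmp := MeasureTheory.measurePreserving_funUnique (haarProbability (UN N)) (Fin 1)
  have hset : {W : EKConfig 1 N | W 0 ∈ S} = (MeasurableEquiv.funUnique (Fin 1) (UN N)) ⁻¹' S := by
    ext W
    simp only [Set.mem_setOf_eq, Set.mem_preimage, MeasurableEquiv.funUnique_apply, Fin.default_eq_zero]
  rw [hset]
  unfold ekHaar
  exact hmp.measure_preimage_equiv S

/-- The links of `Fin.cons U₀ W : EKConfig 2 N`. -/
theorem cons_apply_zero_one (U₀ : UN N) (W : EKConfig 1 N) :
    (Fin.cons U₀ W : EKConfig 2 N) 0 = U₀ ∧ (Fin.cons U₀ W : EKConfig 2 N) 1 = W 0 := ⟨rfl, rfl⟩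

/-! ### The pair reduction -/

/-- **Rank-robust PAIR reduction** (stubs S7/S8 of the v7 architecture of stmt-QuantumFields-27724).  For `s ≤ N` and `0 < t ≤ 1`,
`ekHaar 2 N {U | ∃ R, rank R ≤ s, ‖[U₀,U₁] − R‖_F² ≤ N t} ≤ 33^{N²}(100/t²)^{sN} · ekHaar 2 N {U | ‖[U₀,U₁]‖_F² ≤ 36 N t}`.
Fubini over the first link `U₀`; in each fibre `haar_rankRobust_le` with `D := U₀`. [folklore] -/
theorem ekHaar_two_rankRobust_le {N s : ℕ} (hs : s ≤ N) {t : ℝ} (ht : 0 < t) (ht1 : t ≤ 1) :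
    ekHaar 2 N {U : EKConfig 2 N | ∃ R : Matrix (Fin N) (Fin N) ℂ, R.rank ≤ s ∧
        frobSq (ekComm U 0 1 - R) ≤ (N : ℝ) * t} ≤
      ENNReal.ofReal ((33 : ℝ) ^ (N * N) * (100 / t ^ 2) ^ (s * N)) *
        ekHaar 2 N {U : EKConfig 2 N | frobSq (ekComm U 0 1) ≤ 36 * ((N : ℝ) * t)} := by
  set C : ℝ≥0∞ := ENNReal.ofReal ((33 : ℝ) ^ (N * N) * (100 / t ^ 2) ^ (s * N)) with hC
  rw [ekHaar_succ_eq_lintegral_firstFibre (measurableSet_robustPairEvent N s ((N : ℝ) * t)),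
    ekHaar_succ_eq_lintegral_firstFibre (measurableSet_plainPairEvent N (36 * ((N : ℝ) * t))),
    ← lintegral_const_mul' C _ ENNReal.ofReal_ne_top]
  refine lintegral_mono fun U₀ => ?_
  have h1 : {W : EKConfig 1 N | (Fin.cons U₀ W : EKConfig 2 N) ∈
        {U : EKConfig 2 N | ∃ R : Matrix (Fin N) (Fin N) ℂ, R.rank ≤ s ∧ frobSq (ekComm U 0 1 - R) ≤ (N : ℝ) * t}} =
      {W : EKConfig 1 N | W 0 ∈ {V : UN N | ∃ R : Matrix (Fin N) (Fin N) ℂ, R.rank ≤ s ∧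
        frobSq ((U₀ : Matrix (Fin N) (Fin N) ℂ) * (V : Matrix (Fin N) (Fin N) ℂ) -
          (V : Matrix (Fin N) (Fin N) ℂ) * (U₀ : Matrix (Fin N) (Fin N) ℂ) - R) ≤ (N : ℝ) * t}} := by
    ext W
    simp only [Set.mem_setOf_eq, ekComm, (cons_apply_zero_one U₀ W).1, (cons_apply_zero_one U₀ W).2]
  have h2 : {W : EKConfig 1 N | (Fin.cons U₀ W : EKConfig 2 N) ∈
        {U : EKConfig 2 N | frobSq (ekComm U 0 1) ≤ 36 * ((N : ℝ) * t)}} =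
      {W : EKConfig 1 N | W 0 ∈ {V : UN N |
        frobSq ((U₀ : Matrix (Fin N) (Fin N) ℂ) * (V : Matrix (Fin N) (Fin N) ℂ) -
          (V : Matrix (Fin N) (Fin N) ℂ) * (U₀ : Matrix (Fin N) (Fin N) ℂ)) ≤ 36 * ((N : ℝ) * t)}} := by
    ext W
    simp only [Set.mem_setOf_eq, ekComm, (cons_apply_zero_one U₀ W).1, (cons_apply_zero_one U₀ W).2]
  rw [h1, h2, ekHaar_one_setOf_apply_zero, ekHaar_one_setOf_apply_zero, hC]
  exact haar_rankRobust_le hs U₀ ht ht1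

/-- `‖[U₀,U₁]‖_F² ≤ 2N c ↔ S_R ≤ c` for two links (`N ≥ 1`). -/
theorem frobSq_ekComm_le_iff_ekAction_le (hN : 0 < N) (U : EKConfig 2 N) (c : ℝ) :
    frobSq (ekComm U 0 1) ≤ 2 * (N : ℝ) * c ↔ ekAction U ≤ c := by
  have hN' : (0 : ℝ) < N := by exact_mod_cast hN
  rw [ekAction_eq_sum_ekCommNormSq hN, Fin.sum_univ_two, Fin.sum_univ_two, Fin.sum_univ_two]
  simp only [ekCommNormSq_eq_frobSq, ekComm_self, ekComm_one_zero U, frobSq_neg]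
  have h0 : frobSq (0 : Matrix (Fin N) (Fin N) ℂ) = 0 := by simp [frobSq]
  rw [h0, zero_div]
  have key : 0 + frobSq (ekComm U 0 1) / (4 * (N : ℝ)) + (frobSq (ekComm U 0 1) / (4 * (N : ℝ)) + 0) =
      frobSq (ekComm U 0 1) / (2 * (N : ℝ)) := by ring
  rw [key, div_le_iff₀ (by positivity)]
  constructor <;> intro h <;> linarith

/-- **Rank-robust pair reduction against the reduced action** (`N ≥ 1`): for `s ≤ N`, `0 < t ≤ 1`,
`ekHaar 2 N {U | ∃ R, rank R ≤ s, ‖[U₀,U₁] − R‖_F² ≤ N t} ≤ 33^{N²}(100/t²)^{sN} · ekHaar 2 N {U | S_R(U) ≤ 18 t}` — the input shape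
of the pair small-ball bound (S4). [folklore] -/
theorem ekHaar_two_rankRobust_le_ekAction {N s : ℕ} (hN : 0 < N) (hs : s ≤ N) {t : ℝ} (ht : 0 < t) (ht1 : t ≤ 1) :
    ekHaar 2 N {U : EKConfig 2 N | ∃ R : Matrix (Fin N) (Fin N) ℂ, R.rank ≤ s ∧
        frobSq (ekComm U 0 1 - R) ≤ (N : ℝ) * t} ≤
      ENNReal.ofReal ((33 : ℝ) ^ (N * N) * (100 / t ^ 2) ^ (s * N)) *
        ekHaar 2 N {U : EKConfig 2 N | ekAction U ≤ 18 * t} := by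
  have hset : {U : EKConfig 2 N | frobSq (ekComm U 0 1) ≤ 36 * ((N : ℝ) * t)} =
      {U : EKConfig 2 N | ekAction U ≤ 18 * t} := by
    ext U
    rw [Set.mem_setOf_eq, Set.mem_setOf_eq, ← frobSq_ekComm_le_iff_ekAction_le hN U (18 * t)]
    constructor <;> intro h <;> nlinarith
  rw [← hset]
  exact ekHaar_two_rankRobust_le hs ht ht1

end RankRobust

end Summit.QuantumFields.YangMills.Theorems.EguchiKawaiDirectionLadder

end
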